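import Literature.Analysis.SpecialFunctions.CoffeyCsordas2013.Enclosures
import HarnessLib

/-!
# Coffey–Csordas (2013), 2.5 is FALSE: `S₉(0) = (Φ⁽⁹⁾(0))² − Φ⁽⁸⁾(0)·Φ⁽¹⁰⁾(0) < 0`

Source: M. W. Coffey and G. Csordas, *On the log-concavity of a Jacobi theta function*, Math. Comp. **82**
(2013), no. 284, 2265–2272, doi:10.1090/S0025-5718-2013-02681-6 [CoffeyCsordas2013] — p. 2265 (1.1)–(1.2) (the
function `Φ`), p. 2269 (their statement 2.5 = (2.19) for every `n ≥ 1`); restated verbatim as Open Problem 4.13 of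
G. Csordas, *Fourier transforms of positive definite kernels and the Riemann ξ-function*, CMFT **15** (2015),
arXiv:1309.0055 [Csordas2015].  PRIMARY READ (AMS open PDF, pp. 2265 and 2269) by the producing system, 2026-08-18.

The published statement (p. 2269, verbatim): "**2.5.** The derivatives of the Jacobi theta function, Φ(t), are (strictly)
log-concave on ℝ.  That is, for each n ∈ ℕ, (2.19) `S_n(t) = (Φ⁽ⁿ⁾(t))² − Φ⁽ⁿ⁻¹⁾(t)Φ⁽ⁿ⁺¹⁾(t) > 0` for t ∈ ℝ."
(`ℕ = {1, 2, …}` there; `n = 1` is their Theorem 2.1), with (p. 2265, (1.2)) `Φ(t) := Σ_{n ≥ 1} a_n(t)`,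
`a_n(t) = (2π²n⁴e^{9t} − 3πn²e^{5t})·exp(−πn²e^{4t})` ("we have deleted the usual, inconsequential, factors of 2"),
so that `Ξ(x) = ∫₀^∞ Φ(t) cos(xt) dt`.  CATEGORY: an explicitly labelled conjecture of the paper, REFUTED by the
explicit witness `n = 9`, `t = 0`: `Φ` is even, so `Φ⁽⁹⁾(0) = 0`, while `Φ⁽⁸⁾(0) > 0` and `Φ⁽¹⁰⁾(0) > 0` (the sign
alternation of `Φ⁽²ᵐ⁾(0)` stops at `m = 5`), whence `S₉(0) = −Φ⁽⁸⁾(0)Φ⁽¹⁰⁾(0) ≈ −7.84·10¹⁹ < 0`.  (Evenness is not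
used in the proof: `|Φ⁽⁹⁾(0)| ≤ 2 000 001` is proved instead.)
Modelling conventions: `a n t` is (1.2) literally; `Φ t := ∑' n : ℕ, a (n+1) t` (absolutely convergent, so `tsum` is
the classical sum); `Φ⁽ⁿ⁾ := iteratedDeriv n Φ`, which by `iteratedDeriv_eqOn` IS the classical `n`-th derivative on
`(−1, 1)` (all that is evaluated); `S n t := (iteratedDeriv n Φ t)² − iteratedDeriv (n−1) Φ t · iteratedDeriv (n+1) Φ t`
is (2.19) (natural subtraction harmless as `n ≥ 1`); `AllDerivativesLogConcave := ∀ n ≥ 1, ∀ t, 0 < S n t`.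

This module (§§7–8 of the bundle file).  TAIL (`n + 1 ≥ 5`): `abs_T_tail_le`, `tail_abs_le k : |∑' n, T k (n+4)| ≤
Cpi k · Kc k · e^{−25π/2} · 2` (crude: `|p| ≤ (m + 4c + 4k)^k`, `x^{k+2}/(k+2)! ≤ eˣ`, a geometric series), numerically
`tail_eight : … ≤ 2700`, `tail_nine : … ≤ 2·10⁶`, `tail_ten : … ≤ 1.8·10⁹`.  Then `iteratedDeriv_eight_ge :
233 377 300 ≤ Φ⁽⁸⁾(0)`, `iteratedDeriv_ten_ge : 334 000 000 000 ≤ Φ⁽¹⁰⁾(0)`, `abs_iteratedDeriv_nine_le : |Φ⁽⁹⁾(0)| ≤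
2 000 001`; hence **`S_nine_zero_neg : S 9 0 < 0`**, **`allDerivativesLogConcave_false : ¬ AllDerivativesLogConcave`**,
and `exists_counterexample : ∃ n ≥ 1, ∃ t, S n t < 0`.  Kernel-checked, axioms `[propext, Classical.choice, Quot.sound]`.

Modules: `Literature.Analysis.SpecialFunctions.CoffeyCsordas2013.Derivatives` (§§1–4: `a`, `Φ`, `S`, `AllDerivativesLogConcave`; closed form of all
derivatives of the summands, the summable majorant, termwise differentiation on `(−1,1)`:
`iteratedDeriv_zero_eq k : iteratedDeriv k Φ 0 = ∑' n, T k n`), `.Enclosures` (§§5–6: the head `n+1 ≤ 4` as integer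
polynomials in `π` times powers of `e^{−π}`, 20-digit rational enclosures, four `decide +kernel` evaluations),
`.Sign` (§§7–8: the tail bound, `233 377 300 ≤ Φ⁽⁸⁾(0)`, `3.34·10¹¹ ≤ Φ⁽¹⁰⁾(0)`, `|Φ⁽⁹⁾(0)| ≤ 2 000 001`,
`S_nine_zero_neg : S 9 0 < 0`, `allDerivativesLogConcave_false`).

Provenance: refutations bundle `papers/_cross/refutations` (H21 seat pub-refute-2, 2026-08-18), package module
`Refutations.CoffeyCsordas2013 (§§7–8)`, moved into the tree under the Lean-in-tree rule (human 2026-08-18); the witness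
was found by the bundle's numerics (`numerics/coffey_csordas2013/`, three independent high-precision checkers agree:
`Φ⁽⁸⁾(0) = 2.3338698091…·10⁸`, `Φ⁽¹⁰⁾(0) = 3.3582019884…·10¹¹`, `|Φ⁽⁹⁾(0)| ≤ 3.1·10⁻³⁴`, `S₉(0) ≤ −7.8376·10¹⁹`).
Renamed from the bundle: `Conjecture25 ↦ AllDerivativesLogConcave`, `conjecture25_false ↦ allDerivativesLogConcave_false`.
-/

set_option autoImplicit false

open Real Set Filter Topology

namespace Literature.Analysis.SpecialFunctions.CoffeyCsordas2013

noncomputable section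

/-! ## 7. The tail `N = n + 1 ≥ 5` -/

/-- Constants of the crude tail bound `|T k (n+4)| ≤ Cpi k · Kc k · e^{−π(n+5)²/2}`. [folklore] -/
def Cpi (k : ℕ) : ℝ := 2 * π ^ 2 * (9 + 4 * π + 4 * k) ^ k + 3 * π * (5 + 4 * π + 4 * k) ^ k
/-- Second constant of the crude tail bound: `Kc k = (k+2)!·(2/3)^{k+2}`. [folklore] -/
def Kc (k : ℕ) : ℝ := ((k + 2).factorial : ℝ) * (2 / 3) ^ (k + 2)

/-- Auxiliary lemma: `(k : ℕ) : 0 ≤ Cpi k`. [folklore] -/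
theorem Cpi_nonneg (k : ℕ) : 0 ≤ Cpi k := by unfold Cpi; positivity
/-- Auxiliary lemma: `(k : ℕ) : 0 ≤ Kc k`. [folklore] -/
theorem Kc_nonneg (k : ℕ) : 0 ≤ Kc k := by unfold Kc; positivity

/-- Auxiliary lemma: `(k : ℕ) (N : ℝ) (hN : 1 ≤ N) :`. [folklore] -/
theorem abs_bracket_le (k : ℕ) (N : ℝ) (hN : 1 ≤ N) :
    |2 * π ^ 2 * N ^ 4 * p (π * N ^ 2) k 9 - 3 * π * N ^ 2 * p (π * N ^ 2) k 5|
      ≤ Cpi k * (N ^ 2) ^ (k + 2) := by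
  have hc : 0 ≤ π * N ^ 2 := by positivity
  have h9 := abs_p_le _ hc k 9 (by norm_num)
  have h5 := abs_p_le _ hc k 5 (by norm_num)
  have hN2 : 1 ≤ N ^ 2 := one_le_pow₀ hN
  have hk : (0 : ℝ) ≤ k := k.cast_nonneg
  have hkN : (4 : ℝ) * k * 1 ≤ 4 * k * N ^ 2 := mul_le_mul_of_nonneg_left hN2 (by positivity)
  have e9 : 9 + 4 * (π * N ^ 2) + 4 * k ≤ N ^ 2 * (9 + 4 * π + 4 * k) := by nlinarith [pi_pos]
  have e5 : 5 + 4 * (π * N ^ 2) + 4 * k ≤ N ^ 2 * (5 + 4 * π + 4 * k) := by nlinarith [pi_pos]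
  have p9 : |p (π * N ^ 2) k 9| ≤ (N ^ 2) ^ k * (9 + 4 * π + 4 * k) ^ k :=
    calc _ ≤ (9 + 4 * (π * N ^ 2) + 4 * k) ^ k := h9
      _ ≤ (N ^ 2 * (9 + 4 * π + 4 * k)) ^ k := pow_le_pow_left₀ (by positivity) e9 k
      _ = _ := mul_pow _ _ _
  have p5 : |p (π * N ^ 2) k 5| ≤ (N ^ 2) ^ k * (5 + 4 * π + 4 * k) ^ k :=
    calc _ ≤ (5 + 4 * (π * N ^ 2) + 4 * k) ^ k := h5
      _ ≤ (N ^ 2 * (5 + 4 * π + 4 * k)) ^ k := pow_le_pow_left₀ (by positivity) e5 k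
      _ = _ := mul_pow _ _ _
  have hpow : (N ^ 2) ^ (k + 2) = (N ^ 2) ^ k * N ^ 4 := by rw [pow_add]; ring
  have hX0 : 0 ≤ (N ^ 2) ^ k := by positivity
  have hN24 : N ^ 2 * (N ^ 2) ^ k ≤ (N ^ 2) ^ k * N ^ 4 := by
    have : N ^ 2 * 1 ≤ N ^ 2 * N ^ 2 := mul_le_mul_of_nonneg_left hN2 (by positivity)
    nlinarith
  calc |2 * π ^ 2 * N ^ 4 * p (π * N ^ 2) k 9 - 3 * π * N ^ 2 * p (π * N ^ 2) k 5|
      ≤ |2 * π ^ 2 * N ^ 4 * p (π * N ^ 2) k 9| + |3 * π * N ^ 2 * p (π * N ^ 2) k 5| := abs_sub _ _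
    _ = 2 * π ^ 2 * N ^ 4 * |p (π * N ^ 2) k 9| + 3 * π * N ^ 2 * |p (π * N ^ 2) k 5| := by
        rw [abs_mul (2 * π ^ 2 * N ^ 4), abs_mul (3 * π * N ^ 2),
          abs_of_nonneg (by positivity : (0 : ℝ) ≤ 2 * π ^ 2 * N ^ 4),
          abs_of_nonneg (by positivity : (0 : ℝ) ≤ 3 * π * N ^ 2)]
    _ ≤ 2 * π ^ 2 * N ^ 4 * ((N ^ 2) ^ k * (9 + 4 * π + 4 * k) ^ k)
          + 3 * π * N ^ 2 * ((N ^ 2) ^ k * (5 + 4 * π + 4 * k) ^ k) := by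
        gcongr
    _ ≤ 2 * π ^ 2 * (9 + 4 * π + 4 * k) ^ k * ((N ^ 2) ^ k * N ^ 4)
          + 3 * π * (5 + 4 * π + 4 * k) ^ k * ((N ^ 2) ^ k * N ^ 4) := by
        have hA : 0 ≤ 3 * π * (5 + 4 * π + 4 * k) ^ k := by positivity
        nlinarith [mul_le_mul_of_nonneg_left hN24 hA]
    _ = Cpi k * (N ^ 2) ^ (k + 2) := by rw [hpow, Cpi]; ring

/-- Auxiliary lemma: `(k : ℕ) (N : ℝ) : (N ^ 2) ^ (k + 2) * exp (-(π * N ^ 2)) ≤ Kc k * exp (-(π * N ^ 2 / 2))`. [folklore] -/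
theorem pow_mul_exp_le (k : ℕ) (N : ℝ) :
    (N ^ 2) ^ (k + 2) * exp (-(π * N ^ 2)) ≤ Kc k * exp (-(π * N ^ 2 / 2)) := by
  have hx : 0 ≤ π * N ^ 2 / 2 := by positivity
  have h := Real.pow_div_factorial_le_exp (π * N ^ 2 / 2) hx (k + 2)
  have hfac : (0 : ℝ) < ((k + 2).factorial : ℝ) := by positivity
  rw [div_le_iff₀ hfac] at h
  have hpi3 : 2 / π ≤ (2 : ℝ) / 3 :=
    div_le_div_of_nonneg_left (by norm_num) (by norm_num) pi_gt_three.le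
  have e1 : (N ^ 2) ^ (k + 2) = (2 / π) ^ (k + 2) * (π * N ^ 2 / 2) ^ (k + 2) := by
    rw [← mul_pow]; congr 1; field_simp
  have hA : (2 / π) ^ (k + 2) ≤ ((2 : ℝ) / 3) ^ (k + 2) := pow_le_pow_left₀ (by positivity) hpi3 _
  have hAB : (2 / π) ^ (k + 2) * (π * N ^ 2 / 2) ^ (k + 2)
      ≤ ((2 : ℝ) / 3) ^ (k + 2) * (exp (π * N ^ 2 / 2) * ((k + 2).factorial : ℝ)) :=
    mul_le_mul hA h (by positivity) (by positivity)
  have hexp : exp (π * N ^ 2 / 2) * exp (-(π * N ^ 2)) = exp (-(π * N ^ 2 / 2)) := by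
    rw [← Real.exp_add]; congr 1; ring
  calc (N ^ 2) ^ (k + 2) * exp (-(π * N ^ 2))
      = (2 / π) ^ (k + 2) * (π * N ^ 2 / 2) ^ (k + 2) * exp (-(π * N ^ 2)) := by rw [e1]
    _ ≤ ((2 : ℝ) / 3) ^ (k + 2) * (exp (π * N ^ 2 / 2) * ((k + 2).factorial : ℝ)) * exp (-(π * N ^ 2)) :=
        mul_le_mul_of_nonneg_right hAB (exp_pos _).le
    _ = ((k + 2).factorial : ℝ) * ((2 : ℝ) / 3) ^ (k + 2) * (exp (π * N ^ 2 / 2) * exp (-(π * N ^ 2))) := by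
        ring
    _ = Kc k * exp (-(π * N ^ 2 / 2)) := by rw [hexp, Kc]

/-- Auxiliary lemma: `(n : ℕ) : exp (-(π * ((n : ℝ) + 5) ^ 2 / 2)) ≤ exp (-(25 * π / 2)) * exp (-(5 * π / 2)) ^ n`. [folklore] -/
theorem exp_tail_le (n : ℕ) :
    exp (-(π * ((n : ℝ) + 5) ^ 2 / 2)) ≤ exp (-(25 * π / 2)) * exp (-(5 * π / 2)) ^ n := by
  rw [← Real.exp_nat_mul, ← Real.exp_add]
  apply exp_le_exp.mpr
  have hn : (0 : ℝ) ≤ n := n.cast_nonneg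
  nlinarith [pi_pos, mul_nonneg (mul_nonneg pi_pos.le hn) hn, mul_nonneg pi_pos.le hn]

/-- Auxiliary lemma: `(k n : ℕ) :`. [folklore] -/
theorem abs_T_tail_le (k n : ℕ) :
    |T k (n + 4)| ≤ Cpi k * Kc k * (exp (-(25 * π / 2)) * exp (-(5 * π / 2)) ^ n) := by
  have h3 := exp_tail_le n
  rw [T_eq]
  have hNdef : ((n + 4 : ℕ) : ℝ) + 1 = (n : ℝ) + 5 := by push_cast; ring
  rw [hNdef]
  set N : ℝ := (n : ℝ) + 5 with hN
  have hN1 : 1 ≤ N := by rw [hN]; linarith [n.cast_nonneg (α := ℝ)]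
  rw [abs_mul, abs_of_pos (exp_pos _)]
  have h1 := abs_bracket_le k N hN1
  have h2 := pow_mul_exp_le k N
  have hC := Cpi_nonneg k
  have hK := Kc_nonneg k
  calc |2 * π ^ 2 * N ^ 4 * p (π * N ^ 2) k 9 - 3 * π * N ^ 2 * p (π * N ^ 2) k 5| * exp (-(π * N ^ 2))
      ≤ Cpi k * (N ^ 2) ^ (k + 2) * exp (-(π * N ^ 2)) :=
        mul_le_mul_of_nonneg_right h1 (exp_pos _).le
    _ = Cpi k * ((N ^ 2) ^ (k + 2) * exp (-(π * N ^ 2))) := by ring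
    _ ≤ Cpi k * (Kc k * exp (-(π * N ^ 2 / 2))) := mul_le_mul_of_nonneg_left h2 hC
    _ ≤ Cpi k * (Kc k * (exp (-(25 * π / 2)) * exp (-(5 * π / 2)) ^ n)) :=
        mul_le_mul_of_nonneg_left (mul_le_mul_of_nonneg_left h3 hK) hC
    _ = _ := by ring

/-- Auxiliary lemma: `: exp (-(5 * π / 2)) ≤ 1 / 2`. [folklore] -/
theorem exp_r_le : exp (-(5 * π / 2)) ≤ 1 / 2 := by
  have h1 : exp (-(5 * π / 2)) ≤ exp (-1) := exp_le_exp.mpr (by linarith [pi_gt_three])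
  have h2 := Real.exp_neg_one_lt_d9
  norm_num at h2 ⊢
  linarith

/-- Auxiliary lemma: `(k : ℕ) :`. [folklore] -/
theorem tail_abs_le (k : ℕ) :
    |∑' n : ℕ, T k (n + 4)| ≤ Cpi k * Kc k * exp (-(25 * π / 2)) * 2 := by
  have hs : Summable fun n : ℕ => T k (n + 4) := (summable_nat_add_iff 4).mpr (summable_T k)
  have hr0 : 0 ≤ exp (-(5 * π / 2)) := (exp_pos _).le
  have hr1 : exp (-(5 * π / 2)) < 1 := by linarith [exp_r_le]
  have hg : Summable fun n : ℕ => exp (-(5 * π / 2)) ^ n := summable_geometric_of_lt_one hr0 hr1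
  have hmaj : Summable fun n : ℕ =>
      Cpi k * Kc k * (exp (-(25 * π / 2)) * exp (-(5 * π / 2)) ^ n) :=
    ((hg.mul_left _).mul_left _)
  have hsa : Summable fun n : ℕ => |T k (n + 4)| := hs.abs
  have hsn : Summable fun n : ℕ => ‖T k (n + 4)‖ := by simpa only [Real.norm_eq_abs] using hsa
  have h1 : |∑' n : ℕ, T k (n + 4)| ≤ ∑' n : ℕ, |T k (n + 4)| := by
    have := norm_tsum_le_tsum_norm hsn
    simpa only [Real.norm_eq_abs] using this
  have h2 : ∑' n : ℕ, |T k (n + 4)|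
      ≤ ∑' n : ℕ, Cpi k * Kc k * (exp (-(25 * π / 2)) * exp (-(5 * π / 2)) ^ n) :=
    Summable.tsum_le_tsum (fun n => abs_T_tail_le k n) hsa hmaj
  have h3 : ∑' n : ℕ, Cpi k * Kc k * (exp (-(25 * π / 2)) * exp (-(5 * π / 2)) ^ n)
      = Cpi k * Kc k * (exp (-(25 * π / 2)) * (1 - exp (-(5 * π / 2)))⁻¹) := by
    rw [tsum_mul_left, tsum_mul_left, tsum_geometric_of_lt_one hr0 hr1]
  have h4 : (1 - exp (-(5 * π / 2)))⁻¹ ≤ 2 := by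
    rw [inv_le_comm₀ (by linarith) (by norm_num)]
    linarith [exp_r_le]
  have hC := Cpi_nonneg k
  have hK := Kc_nonneg k
  have hE : 0 ≤ exp (-(25 * π / 2)) := (exp_pos _).le
  calc |∑' n : ℕ, T k (n + 4)| ≤ _ := h1
    _ ≤ _ := h2
    _ = _ := h3
    _ ≤ Cpi k * Kc k * (exp (-(25 * π / 2)) * 2) :=
        mul_le_mul_of_nonneg_left (mul_le_mul_of_nonneg_left h4 hE) (mul_nonneg hC hK)
    _ = _ := by ring

/-- Numerical form of the tail bound: `π ≤ 3.15`, `e^{−25π/2} ≤ e^{−39} ≤ 0.3678794412³⁹`. [folklore] -/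
theorem Cpi_le (k : ℕ) :
    Cpi k ≤ 2 * ((63 : ℝ) / 20) ^ 2 * (9 + 4 * ((63 : ℝ) / 20) + 4 * k) ^ k
      + 3 * ((63 : ℝ) / 20) * (5 + 4 * ((63 : ℝ) / 20) + 4 * k) ^ k := by
  have hpi : π ≤ (63 : ℝ) / 20 := by
    have := Real.pi_lt_d2; norm_num at this ⊢; linarith
  unfold Cpi
  gcongr

/-- Auxiliary lemma: `: exp (-(25 * π / 2)) ≤ ((3678794412 : ℝ) / 10000000000) ^ 39`. [folklore] -/
theorem exp_39_le : exp (-(25 * π / 2)) ≤ ((3678794412 : ℝ) / 10000000000) ^ 39 := by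
  have h1 : exp (-(25 * π / 2)) ≤ exp (-39) :=
    exp_le_exp.mpr (by have := Real.pi_gt_d2; norm_num at this; linarith)
  have h2 : exp (-39) = exp (-1) ^ 39 := by rw [← Real.exp_nat_mul]; norm_num
  have h3 : exp (-1) ^ 39 ≤ ((3678794412 : ℝ) / 10000000000) ^ 39 :=
    pow_le_pow_left₀ (exp_pos _).le
      (by have := Real.exp_neg_one_lt_d9; norm_num at this; linarith) 39
  rw [h2] at h1
  exact h1.trans h3

/-- Auxiliary lemma: `(k : ℕ) (B : ℝ) (hB : (2 * ((63 : ℝ) / 20) ^ 2 * (9 + 4 * ((63 : ℝ) / 20) + 4 * k) ^ k + 3 * ((63 : ℝ) / 20) * (5 + 4 * ((63 : ℝ) / 20) + 4 * k) ^ k) * (((k + 2).factorial : ℝ) * (2 / 3) ^ (k + 2)) * ((3678794412 : ℝ)…`. [folklore] -/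
theorem tail_num (k : ℕ) (B : ℝ)
    (hB : (2 * ((63 : ℝ) / 20) ^ 2 * (9 + 4 * ((63 : ℝ) / 20) + 4 * k) ^ k
        + 3 * ((63 : ℝ) / 20) * (5 + 4 * ((63 : ℝ) / 20) + 4 * k) ^ k)
        * (((k + 2).factorial : ℝ) * (2 / 3) ^ (k + 2))
        * ((3678794412 : ℝ) / 10000000000) ^ 39 * 2 ≤ B) :
    |∑' n : ℕ, T k (n + 4)| ≤ B := by
  have h := tail_abs_le k
  have hC := Cpi_le k
  have hE := exp_39_le
  have hK0 := Kc_nonneg k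
  have hE0 : 0 ≤ exp (-(25 * π / 2)) := (exp_pos _).le
  have a1 : Cpi k * Kc k ≤ _ := mul_le_mul_of_nonneg_right hC hK0
  have a2 : Cpi k * Kc k * exp (-(25 * π / 2)) ≤ _ :=
    mul_le_mul a1 hE hE0 (mul_nonneg (by positivity) hK0)
  have a3 := mul_le_mul_of_nonneg_right a2 (by norm_num : (0 : ℝ) ≤ 2)
  unfold Kc at h a3
  linarith

/-- Auxiliary lemma: `: |∑' n : ℕ, T 8 (n + 4)| ≤ 2700`. [folklore] -/
theorem tail_eight : |∑' n : ℕ, T 8 (n + 4)| ≤ 2700 :=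
  tail_num 8 _ (by norm_num [Nat.factorial])
/-- Auxiliary lemma: `: |∑' n : ℕ, T 9 (n + 4)| ≤ 2000000`. [folklore] -/
theorem tail_nine : |∑' n : ℕ, T 9 (n + 4)| ≤ 2000000 :=
  tail_num 9 _ (by norm_num [Nat.factorial])
/-- Auxiliary lemma: `: |∑' n : ℕ, T 10 (n + 4)| ≤ 1800000000`. [folklore] -/
theorem tail_ten : |∑' n : ℕ, T 10 (n + 4)| ≤ 1800000000 :=
  tail_num 10 _ (by norm_num [Nat.factorial])

/-! ## 8. The values `Φ⁽⁸⁾(0)`, `Φ⁽⁹⁾(0)`, `Φ⁽¹⁰⁾(0)` and the sign of `S₉(0)` -/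

/-- Auxiliary lemma: `(k : ℕ) : iteratedDeriv k Φ 0 = ∑ n ∈ Finset.range 4, T k n + ∑' n : ℕ, T k (n + 4)`. [folklore] -/
theorem iteratedDeriv_split (k : ℕ) :
    iteratedDeriv k Φ 0 = ∑ n ∈ Finset.range 4, T k n + ∑' n : ℕ, T k (n + 4) := by
  rw [iteratedDeriv_zero_eq, (summable_T k).sum_add_tsum_nat_add 4]

/-- `Φ⁽⁸⁾(0) ≥ 233 377 300` (true value `233 386 980.91…`). [folklore] -/
theorem iteratedDeriv_eight_ge : (233377300 : ℝ) ≤ iteratedDeriv 8 Φ 0 := by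
  rw [iteratedDeriv_split]
  have hh := (head_bounds 8).1
  have hd : ((233380000 : ℚ) : ℝ) ≤ ((headLoQ 8 : ℚ) : ℝ) := by exact_mod_cast headLo_eight
  have ht := (abs_le.mp tail_eight).1
  push_cast at hd
  linarith

/-- `Φ⁽¹⁰⁾(0) ≥ 334 000 000 000` (true value `335 820 198 840.40…`). [folklore] -/
theorem iteratedDeriv_ten_ge : (334000000000 : ℝ) ≤ iteratedDeriv 10 Φ 0 := by
  rw [iteratedDeriv_split]
  have hh := (head_bounds 10).1
  have hd : ((335800000000 : ℚ) : ℝ) ≤ ((headLoQ 10 : ℚ) : ℝ) := by exact_mod_cast headLo_ten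
  have ht := (abs_le.mp tail_ten).1
  push_cast at hd
  linarith

/-- `|Φ⁽⁹⁾(0)| ≤ 2 000 001` (true value `0`: `Φ` is even, Theorem A (iii) of the paper). [folklore] -/
theorem abs_iteratedDeriv_nine_le : |iteratedDeriv 9 Φ 0| ≤ 2000001 := by
  rw [iteratedDeriv_split, abs_le]
  have hh := head_bounds 9
  have hd1 : ((-1 : ℚ) : ℝ) ≤ ((headLoQ 9 : ℚ) : ℝ) := by exact_mod_cast headLo_nine
  have hd2 : ((headHiQ 9 : ℚ) : ℝ) ≤ ((1 : ℚ) : ℝ) := by exact_mod_cast headHi_nine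
  have ht := abs_le.mp tail_nine
  push_cast at hd1 hd2
  constructor <;> linarith [hh.1, hh.2, ht.1, ht.2]

/-- **The counterexample.** `S₉(0) = (Φ⁽⁹⁾(0))² − Φ⁽⁸⁾(0)·Φ⁽¹⁰⁾(0) < 0`
(numerically `S₉(0) = −Φ⁽⁸⁾(0)·Φ⁽¹⁰⁾(0) ≈ −7.84·10¹⁹`). [folklore] -/
theorem S_nine_zero_neg : S 9 0 < 0 := by
  have h8 := iteratedDeriv_eight_ge
  have h10 := iteratedDeriv_ten_ge
  have h9 := abs_iteratedDeriv_nine_le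
  have hsq : iteratedDeriv 9 Φ 0 ^ 2 ≤ 2000001 ^ 2 := by
    rw [← sq_abs]; exact pow_le_pow_left₀ (abs_nonneg _) h9 2
  have hprod := mul_nonneg (sub_nonneg.mpr h8) (sub_nonneg.mpr h10)
  show iteratedDeriv 9 Φ 0 ^ 2 - iteratedDeriv (9 - 1) Φ 0 * iteratedDeriv (9 + 1) Φ 0 < 0
  norm_num
  nlinarith

/-- Statement 2.5 of Coffey–Csordas (2013) is false: witness `n = 9`, `t = 0` (`S_nine_zero_neg`). [folklore] -/
theorem allDerivativesLogConcave_false : ¬ AllDerivativesLogConcave := fun h =>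
  absurd (h 9 (by norm_num) 0) (not_lt.mpr S_nine_zero_neg.le)

/-- The witness in existential form (used by the bundle index). [folklore] -/
theorem exists_counterexample : ∃ n : ℕ, 1 ≤ n ∧ ∃ t : ℝ, S n t < 0 :=
  ⟨9, by norm_num, 0, S_nine_zero_neg⟩

end

end Literature.Analysis.SpecialFunctions.CoffeyCsordas2013
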